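import Summits.AtomisticToContinuum.HydrodynamicLimit.Theses.HeatBathForgetting

/-!
# Birth skeleton (BC3) for crux `RefreshToClosure`
(stmt-AtomisticToContinuum-9452, route `HeatBathForgetting`, rank 4, sub `HydrodynamicLimit`)

Crux (FIXED, imported by name):
`Summit.AtomisticToContinuum.HydrodynamicLimit.Theses.HeatBathForgetting.RefreshToClosure :=
CellRefresh → CubicMomentUI → MesoFluxClosure` — FORGETTING ⇒ CLOSURE (the Dobrushin–Shlosman
identification step at finite `N`).

Cut of the crux along the route's own intended proof ("cut `[t₁,t₂]` into windows of length
`τ_N = (N+1)^{-1/12}`; resample every cell microcanonically at the window start; the Gibbsianised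
law's mean flux is the Euler flux; `CubicMomentUI` truncates the unbounded flux observables"),
typed WITHOUT a resampling kernel: a randomised admissible surgery is a finite convex combination
of `CellRefresh`-admissible maps (`IsAdmissible`), and velocity weights are truncated by the fixed
continuous cutoff `cutoff K` so that `CellRefresh` (bounded one-particle cell observables) applies.
Block scale `h = (N+1)^{-α}` with `α < 1/12`: blocks are larger than the acoustic window scale
`c·τ_N`, so the block Euler flux is frozen over a window (clause (c) of `AprioriBlockFlux`).

Registered stubs (the open obligations; `sorry` only here):
* `stub_fieldRefresh`            (M)  `CellRefresh → FieldRefresh` — law-level forgetting transferred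
  from normalised cell observables to the tested one-particle fields `ζ(q)·w(v)`, `ζ` smooth, `w`
  continuous with compact support (lattice partition of unity by translates of one bump at scale
  `h_N`, local constancy of `ζ` (error `O(h_N) = o(τ_N)`), uniformity of `CellRefresh` in the centre).
* `stub_gibbsianisedWindowFlux`  (XL, THE HEART) `CubicMomentUI → GibbsianisedWindowFlux` — on every
  window `[s, s+τ_N]` there is a randomised admissible surgery (cellwise re-randomisation) which
  (i) moves the truncated tested conserved fields at time `s` by `≤ δτ_N` in mean and (ii) after
  which the mean lag-`τ_N` increment of each truncated tested conserved field is `τ_N ×` the mean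
  block Euler flux functional frozen at time `s`, `± δτ_N`. Contains: existence of admissible
  scramblers averaging to the resampling, the window entropy bound `N^{11/12} = o(N)`, the
  virial/EOS identification (uses `HsEosLowDensity_holds`), and the mesoscopic commutation
  `F(block average) ≈ average of F(cell parameters)`.
* `stub_aprioriBlockFlux`        (L)  `CubicMomentUI → AprioriBlockFlux` — a-priori package along the
  TRUE evolution: joint `(z, r)`-integrability of the block flux functionals, integrability and a
  uniform bound at each time, slow variation of the mean block flux at the window scale
  (`α < 1/12`), mean equicontinuity in time of the tested conserved fields (kinetic transport by
  cubic moments + collisional transfer `O(ε ×` mean collision rate`)`).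
* `stub_windowsToClosure`        (M/L) `FieldRefresh → GibbsianisedWindowFlux → AprioriBlockFlux →
  CubicMomentUI → MesoFluxClosure` — per-window assembly (convexity + (i) + (ii) + field refresh,
  `≤ 3δτ_N` per window), telescoping over `⌊(t₂−t₁)/τ_N⌋` windows, Riemann sum of the frozen flux
  vs. the time integral (slow variation + Fubini), remainder window (equicontinuity), removal of
  the velocity truncation at the two endpoints only (tails telescope; `CubicMomentUI`).

Composition `RefreshToClosure_of` is PROVED (pure logic, no `sorry`):
`fun hCR hUI => windows (field hCR) (heart hUI) (apriori hUI) hUI`.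

Disproof used: none on file for this crux (`ledger crux ls`: no Disproof.lean, negatives index has
no entry on these decls, 2026-08-17).
-/

noncomputable section

open scoped BigOperators Classical
open MeasureTheory Set

namespace Summit.AtomisticToContinuum.HydrodynamicLimit.Cruxes.RefreshToClosure.Birth

open Literature.MathematicalPhysics.KineticTheory
open Literature.Analysis.FluidPDE (HardSphereFlow Config empiricalMeasure liouville hardSphereDomain)
open Summit.AtomisticToContinuum.HydrodynamicLimit.Theses.HeatBathForgetting
  (CellRefresh CubicMomentUI MesoFluxClosure RefreshToClosure)

/-! ### Vocabulary (abbreviations of the crux's own expressions; no new mathematics) -/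

/-- The route's window `τ_N = (N+1)^{-1/12}` (verbatim the `let τN` of `CellRefresh`). -/
def tauN (N : ℕ) : ℝ := ((N + 1 : ℕ) : ℝ) ^ (-(1 / 12 : ℝ))

/-- The route's cell index at mesh `1/M`, `M = ⌊(N+1)^{1/4}⌋` (verbatim the `let cell` of `CellRefresh`). -/
def cellIndex (N : ℕ) (y : T3) (j : Fin 3) : ℤ :=
  ⌊((⌊((N + 1 : ℕ) : ℝ) ^ (1 / 4 : ℝ)⌋₊ : ℕ) : ℝ) * Literature.Analysis.FunctionSpaces.Torus.repr y j⌋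

/-- ADMISSIBLE SURGERY at `(σ, N)` — exactly the four hypotheses on `Ψ` in `CellRefresh`: Liouville-preserving,
hard-core preserving, keeps every particle in its grid cell, conserves the momentum and the kinetic energy
of every cell. -/
def IsAdmissible (σ : ℝ) (N : ℕ) (Ψ : Config (N + 1) (Fin 3) T3 → Config (N + 1) (Fin 3) T3) : Prop :=
  MeasurePreserving Ψ
      (liouville (Literature.Analysis.FluidPDE.Torus.geometry (Fin 3)) (N + 1) (hsDiameter σ N))
      (liouville (Literature.Analysis.FluidPDE.Torus.geometry (Fin 3)) (N + 1) (hsDiameter σ N)) ∧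
  (∀ z ∈ hardSphereDomain (Literature.Analysis.FluidPDE.Torus.geometry (Fin 3)) (N + 1) (hsDiameter σ N),
      Ψ z ∈ hardSphereDomain (Literature.Analysis.FluidPDE.Torus.geometry (Fin 3)) (N + 1) (hsDiameter σ N)) ∧
  (∀ z i, cellIndex N (Ψ z i).1 = cellIndex N (z i).1) ∧
  (∀ z (c : Fin 3 → ℤ),
      (∑ i ∈ Finset.univ.filter (fun i => cellIndex N (z i).1 = c), (Ψ z i).2) =
          ∑ i ∈ Finset.univ.filter (fun i => cellIndex N (z i).1 = c), (z i).2 ∧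
      (∑ i ∈ Finset.univ.filter (fun i => cellIndex N (z i).1 = c), ‖(Ψ z i).2‖ ^ 2) =
          ∑ i ∈ Finset.univ.filter (fun i => cellIndex N (z i).1 = c), ‖(z i).2‖ ^ 2)

/-- Tested one-particle field `⟨μ_z, ζ ⊗ w⟩ = (N+1)⁻¹ ∑ᵢ ζ(qᵢ) w(vᵢ)`. With `w = ‖·‖²/2` this is
`empiricalEnergyField z ζ`, with `w = (·) k` the `k`-th component of `empiricalMomentumField z ζ`. -/
def testObs {N : ℕ} (ζ : T3 → ℝ) (w : V3 → ℝ) (z : Config (N + 1) (Fin 3) T3) : ℝ :=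
  ∫ y, ζ y.1 * w y.2 ∂(empiricalMeasure z)

/-- Fixed continuous velocity cutoff: `1` on `‖v‖ ≤ K`, `0` on `‖v‖ ≥ K + 1`, affine in between. -/
def cutoff (K : ℝ) (v : V3) : ℝ := max 0 (min 1 (K + 1 - ‖v‖))

/-- Truncated kinetic-energy weight `cutoff_K(v)·‖v‖²/2` (bounded, continuous, compactly supported). -/
def wE (K : ℝ) (v : V3) : ℝ := cutoff K v * (‖v‖ ^ 2 / 2)

/-- Truncated `k`-momentum weight `cutoff_K(v)·v_k` (bounded, continuous, compactly supported). -/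
def wM (K : ℝ) (k : Fin 3) (v : V3) : ℝ := cutoff K v * v k

/-- Block density at scale `h` (verbatim the `let ρb` of `MesoFluxClosure`). -/
def rhoB {N : ℕ} (h : ℝ) (z : Config (N + 1) (Fin 3) T3) (x : T3) : ℝ :=
  empiricalDensityField z (fun y => Literature.Analysis.FunctionSpaces.Torus.kernel h (y - x))

/-- Block momentum at scale `h` (verbatim the `let mb` of `MesoFluxClosure`). -/
def momB {N : ℕ} (h : ℝ) (z : Config (N + 1) (Fin 3) T3) (x : T3) : V3 :=
  empiricalMomentumField z (fun y => Literature.Analysis.FunctionSpaces.Torus.kernel h (y - x))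

/-- Block energy at scale `h` (verbatim the `let eb` of `MesoFluxClosure`). -/
def enB {N : ℕ} (h : ℝ) (z : Config (N + 1) (Fin 3) T3) (x : T3) : ℝ :=
  empiricalEnergyField z (fun y => Literature.Analysis.FunctionSpaces.Torus.kernel h (y - x))

/-- Block pressure by the hard-sphere equation of state (verbatim the `let pb` of `MesoFluxClosure`). -/
def prB {N : ℕ} (σ h : ℝ) (z : Config (N + 1) (Fin 3) T3) (x : T3) : ℝ :=
  hsPressure σ (rhoB h z x) (2 / 3 * (enB h z x / rhoB h z x - ‖momB h z x‖ ^ 2 / (2 * rhoB h z x ^ 2)))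

/-- `m_b · ∇ζ` (verbatim the `let mg` of `MesoFluxClosure`). -/
def mgB {N : ℕ} (h : ℝ) (ζ : T3 → ℝ) (z : Config (N + 1) (Fin 3) T3) (x : T3) : ℝ :=
  ∑ j : Fin 3, momB h z x j * Literature.Analysis.FunctionSpaces.Torus.partialDeriv j ζ x

/-- Block Euler ENERGY flux functional `∫ (e_b + p_b)/ρ_b · (m_b·∇ζ) dx` (the time-integrand of the
`let Den` of `MesoFluxClosure`). -/
def fluxE {N : ℕ} (σ h : ℝ) (ζ : T3 → ℝ) (z : Config (N + 1) (Fin 3) T3) : ℝ :=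
  ∫ x, (enB h z x + prB σ h z x) / rhoB h z x * mgB h ζ z x

/-- Block Euler `k`-MOMENTUM flux functional `∫ ((m_b·∇ζ) m_{b,k}/ρ_b + p_b ∂_k ζ) dx` (the time-integrand
of the `let Dmo k` of `MesoFluxClosure`). -/
def fluxM {N : ℕ} (σ h : ℝ) (ζ : T3 → ℝ) (k : Fin 3) (z : Config (N + 1) (Fin 3) T3) : ℝ :=
  ∫ x, (mgB h ζ z x * momB h z x k / rhoB h z x + prB σ h z x * Literature.Analysis.FunctionSpaces.Torus.partialDeriv k ζ x)

/-! ### The statements of the line (named `Prop`s; same prefix as the route's items) -/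

/-- **FieldRefresh** — LAW-LEVEL FORGETTING FOR TESTED ONE-PARTICLE FIELDS. Along the true evolution from
local Gibbs data (`σ < σ₀`, horizon `t < T`): for every smooth `ζ` and every continuous compactly supported
velocity weight `w`, applying ANY admissible surgery `Ψ` at any time `s ≤ t` changes the expectation of
`⟨μ, ζ ⊗ w⟩` at time `s + τ_N` by at most `δ·τ_N`, uniformly in `s` and `Ψ`, for `N ≥ N₀(ζ, w, δ, t)`.
(`CellRefresh` transferred from normalised cell observables: partition of unity at scale `h_N` by translates
of one bump, `ζ` frozen at cell centres at cost `O(h_N) = o(τ_N)`.) -/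
def FieldRefresh : Prop :=
  ∀ (a₀ θ₀ : T3 → ℝ) (u₀ : T3 → V3), Continuous a₀ → Continuous θ₀ → Continuous u₀ →
    (∀ x, 0 < a₀ x) → (∀ x, 0 < θ₀ x) →
    ∃ σ₀ : ℝ, 0 < σ₀ ∧ ∀ σ : ℝ, 0 < σ → σ < σ₀ →
      ∀ (T : ℝ) (ρ θ : ℝ → T3 → ℝ) (u : ℝ → T3 → V3), IsHardSphereEulerSolution σ T ρ u θ →
        ∀ Φ : (N : ℕ) → HardSphereFlow (Literature.Analysis.FluidPDE.Torus.geometry (Fin 3)) (hsDiameter σ N) (N + 1),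
          TendstoHydroFieldsAt (fun N => localGibbsLaw σ a₀ u₀ θ₀ N (Φ N)) Φ ρ u θ 0 →
            ∀ t ∈ Set.Ico 0 T, ∀ ζ : T3 → ℝ, Literature.Analysis.FunctionSpaces.Torus.IsSmooth ζ →
              ∀ w : V3 → ℝ, Continuous w → HasCompactSupport w →
                ∀ δ : ℝ, 0 < δ → ∃ N₀ : ℕ, ∀ N : ℕ, N₀ ≤ N → ∀ s ∈ Set.Icc 0 t,
                  ∀ Ψ : Config (N + 1) (Fin 3) T3 → Config (N + 1) (Fin 3) T3, IsAdmissible σ N Ψ →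
                    |(∫ z, testObs ζ w ((Φ N).flow (s + tauN N) z) ∂(localGibbsLaw σ a₀ u₀ θ₀ N (Φ N))) -
                        ∫ z, testObs ζ w ((Φ N).flow (tauN N) (Ψ ((Φ N).flow s z)))
                          ∂(localGibbsLaw σ a₀ u₀ θ₀ N (Φ N))| ≤ δ * tauN N

/-- **GibbsianisedWindowFlux** — THE HEART (Gibbsianisation costs `o(τ_N)` in mean and the Gibbsianised law
closes on the frozen block Euler flux). There is a block exponent `0 < α < 1/12` such that along the true
evolution from local Gibbs data, for every `t < T`, smooth `ζ`, `δ > 0`, all truncation levels `K ≥ K₁(δ)`,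
`N ≥ N₀(K)` and every window `[s, s + τ_N] ⊆ [0, t]`, there is a RANDOMISED ADMISSIBLE SURGERY — finitely many
admissible maps `Ψᵢ` with convex weights `wtᵢ` (the cellwise microcanonical re-randomisation, or any
approximation of it) — such that for the truncated tested energy field `⟨μ, ζ ⊗ wE_K⟩` and each truncated
tested momentum field `⟨μ, ζ ⊗ wM_K k⟩`:
(i) the surgery moves the field at time `s` by `≤ δτ_N` in mean (local equilibrium of the velocity tails
at rate `o(τ_N)`), and (ii) after the surgery the mean lag-`τ_N` increment of the field equals
`τ_N ×` the mean block Euler flux functional (`fluxE`, resp. `fluxM k`, block scale `(N+1)^{-α}`) of the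
TRUE configuration at time `s`, `± δτ_N` (window entropy `h_N⁻⁴τ_N = N^{11/12} = o(N)`, virial theorem and
low-density equation of state, commutation of `F` with the block average over `N^{3(1/4-α)}` cells). -/
def GibbsianisedWindowFlux : Prop :=
  ∀ (a₀ θ₀ : T3 → ℝ) (u₀ : T3 → V3), Continuous a₀ → Continuous θ₀ → Continuous u₀ →
    (∀ x, 0 < a₀ x) → (∀ x, 0 < θ₀ x) →
    ∃ σ₀ : ℝ, 0 < σ₀ ∧ ∀ σ : ℝ, 0 < σ → σ < σ₀ →
      ∀ (T : ℝ) (ρ θ : ℝ → T3 → ℝ) (u : ℝ → T3 → V3), IsHardSphereEulerSolution σ T ρ u θ →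
        ∀ Φ : (N : ℕ) → HardSphereFlow (Literature.Analysis.FluidPDE.Torus.geometry (Fin 3)) (hsDiameter σ N) (N + 1),
          TendstoHydroFieldsAt (fun N => localGibbsLaw σ a₀ u₀ θ₀ N (Φ N)) Φ ρ u θ 0 →
            ∃ α : ℝ, 0 < α ∧ α < 1 / 12 ∧
              ∀ t ∈ Set.Ico 0 T, ∀ ζ : T3 → ℝ, Literature.Analysis.FunctionSpaces.Torus.IsSmooth ζ →
                ∀ δ : ℝ, 0 < δ → ∃ K₁ : ℝ, ∀ K : ℝ, K₁ ≤ K → ∃ N₀ : ℕ, ∀ N : ℕ, N₀ ≤ N →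
                  ∀ s : ℝ, 0 ≤ s → s + tauN N ≤ t →
                    ∃ (m : ℕ) (wt : Fin m → ℝ)
                      (Ψ : Fin m → Config (N + 1) (Fin 3) T3 → Config (N + 1) (Fin 3) T3),
                      (∀ i, 0 ≤ wt i) ∧ ∑ i, wt i = 1 ∧ (∀ i, IsAdmissible σ N (Ψ i)) ∧
                      (let P := localGibbsLaw σ a₀ u₀ θ₀ N (Φ N)
                       let h : ℝ := ((N + 1 : ℕ) : ℝ) ^ (-α)
                       (|(∑ i, wt i * ∫ z, testObs ζ (wE K) (Ψ i ((Φ N).flow s z)) ∂P) -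
                            ∫ z, testObs ζ (wE K) ((Φ N).flow s z) ∂P| ≤ δ * tauN N ∧
                        |(∑ i, wt i * ((∫ z, testObs ζ (wE K) ((Φ N).flow (tauN N) (Ψ i ((Φ N).flow s z))) ∂P) -
                            ∫ z, testObs ζ (wE K) (Ψ i ((Φ N).flow s z)) ∂P)) -
                            tauN N * ∫ z, fluxE σ h ζ ((Φ N).flow s z) ∂P| ≤ δ * tauN N) ∧
                       ∀ k : Fin 3,
                        |(∑ i, wt i * ∫ z, testObs ζ (wM K k) (Ψ i ((Φ N).flow s z)) ∂P) -
                            ∫ z, testObs ζ (wM K k) ((Φ N).flow s z) ∂P| ≤ δ * tauN N ∧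
                        |(∑ i, wt i * ((∫ z, testObs ζ (wM K k) ((Φ N).flow (tauN N) (Ψ i ((Φ N).flow s z))) ∂P) -
                            ∫ z, testObs ζ (wM K k) (Ψ i ((Φ N).flow s z)) ∂P)) -
                            tauN N * ∫ z, fluxM σ h ζ k ((Φ N).flow s z) ∂P| ≤ δ * tauN N)

/-- **AprioriBlockFlux** — A-PRIORI PACKAGE ALONG THE TRUE EVOLUTION (every block exponent `0 < α < 1/12`,
every `t < T`, smooth `ζ`; `N ≥ N₀`, constant `C`): (a) the block Euler flux functionals `r ↦ fluxE/fluxM (Φ_r z)`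
are jointly integrable on `P × [0, t]` (Fubini is available); (b) at each time `r ≤ t` they and the tested
conserved fields are `P`-integrable and the mean block fluxes are bounded by `C`; (c) the MEAN block fluxes vary
by `≤ δ` over time lags `≤ τ_N` (blocks of side `(N+1)^{-α} ≫ c·τ_N` are slow: kinetic transport across a block
face costs `τ_N/h`, collisional transfer `ε/h` per collision) and the mean tested conserved fields are
equicontinuous in time uniformly in `N` (mean currents bounded: cubic moments for the kinetic part,
`ε ×` mean collision rate for the transfer part). -/
def AprioriBlockFlux : Prop :=
  ∀ (a₀ θ₀ : T3 → ℝ) (u₀ : T3 → V3), Continuous a₀ → Continuous θ₀ → Continuous u₀ →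
    (∀ x, 0 < a₀ x) → (∀ x, 0 < θ₀ x) →
    ∃ σ₀ : ℝ, 0 < σ₀ ∧ ∀ σ : ℝ, 0 < σ → σ < σ₀ →
      ∀ (T : ℝ) (ρ θ : ℝ → T3 → ℝ) (u : ℝ → T3 → V3), IsHardSphereEulerSolution σ T ρ u θ →
        ∀ Φ : (N : ℕ) → HardSphereFlow (Literature.Analysis.FluidPDE.Torus.geometry (Fin 3)) (hsDiameter σ N) (N + 1),
          TendstoHydroFieldsAt (fun N => localGibbsLaw σ a₀ u₀ θ₀ N (Φ N)) Φ ρ u θ 0 →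
            ∀ α : ℝ, 0 < α → α < 1 / 12 →
              ∀ t ∈ Set.Ico 0 T, ∀ ζ : T3 → ℝ, Literature.Analysis.FunctionSpaces.Torus.IsSmooth ζ →
                (∃ N₀ : ℕ, ∃ C : ℝ, ∀ N : ℕ, N₀ ≤ N →
                  (let P := localGibbsLaw σ a₀ u₀ θ₀ N (Φ N)
                   let h : ℝ := ((N + 1 : ℕ) : ℝ) ^ (-α)
                   (Integrable (fun p : Config (N + 1) (Fin 3) T3 × ℝ => fluxE σ h ζ ((Φ N).flow p.2 p.1))
                        (P.prod (volume.restrict (Set.Icc 0 t))) ∧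
                      ∀ k : Fin 3, Integrable
                        (fun p : Config (N + 1) (Fin 3) T3 × ℝ => fluxM σ h ζ k ((Φ N).flow p.2 p.1))
                        (P.prod (volume.restrict (Set.Icc 0 t)))) ∧
                   ∀ r ∈ Set.Icc 0 t,
                      Integrable (fun z => fluxE σ h ζ ((Φ N).flow r z)) P ∧
                      |∫ z, fluxE σ h ζ ((Φ N).flow r z) ∂P| ≤ C ∧
                      Integrable (fun z => empiricalEnergyField ((Φ N).flow r z) ζ) P ∧
                      ∀ k : Fin 3,
                        Integrable (fun z => fluxM σ h ζ k ((Φ N).flow r z)) P ∧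
                        |∫ z, fluxM σ h ζ k ((Φ N).flow r z) ∂P| ≤ C ∧
                        Integrable (fun z => empiricalMomentumField ((Φ N).flow r z) ζ k) P)) ∧
                (∀ δ : ℝ, 0 < δ → ∃ ℓ₀ : ℝ, 0 < ℓ₀ ∧ ∃ N₁ : ℕ, ∀ N : ℕ, N₁ ≤ N →
                  (let P := localGibbsLaw σ a₀ u₀ θ₀ N (Φ N)
                   let h : ℝ := ((N + 1 : ℕ) : ℝ) ^ (-α)
                   ∀ r₁ ∈ Set.Icc 0 t, ∀ r₂ ∈ Set.Icc 0 t,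
                    (|r₁ - r₂| ≤ tauN N →
                      |(∫ z, fluxE σ h ζ ((Φ N).flow r₁ z) ∂P) - ∫ z, fluxE σ h ζ ((Φ N).flow r₂ z) ∂P| ≤ δ ∧
                      ∀ k : Fin 3,
                        |(∫ z, fluxM σ h ζ k ((Φ N).flow r₁ z) ∂P) - ∫ z, fluxM σ h ζ k ((Φ N).flow r₂ z) ∂P| ≤ δ) ∧
                    (|r₁ - r₂| ≤ ℓ₀ →
                      |(∫ z, empiricalEnergyField ((Φ N).flow r₁ z) ζ ∂P) -
                          ∫ z, empiricalEnergyField ((Φ N).flow r₂ z) ζ ∂P| ≤ δ ∧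
                      ∀ k : Fin 3,
                        |(∫ z, empiricalMomentumField ((Φ N).flow r₁ z) ζ k ∂P) -
                          ∫ z, empiricalMomentumField ((Φ N).flow r₂ z) ζ k ∂P| ≤ δ)))

/-! ### Registered stubs (the open obligations of the line; `sorry` only here) -/

/-- STUB 1 (M): `CellRefresh` ⇒ field-level forgetting for smooth-in-`x`, bounded-compactly-supported-in-`v`
one-particle test functions (partition of unity at scale `h_N`, `ζ` frozen on cells, uniformity in the centre). -/
theorem stub_fieldRefresh : CellRefresh → FieldRefresh := by
  sorry

/-- STUB 2 (XL; THE HEART): Gibbsianisation by a randomised admissible surgery costs `o(τ_N)` in mean and the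
Gibbsianised law closes on the frozen block Euler flux over one window. -/
theorem stub_gibbsianisedWindowFlux : CubicMomentUI → GibbsianisedWindowFlux := by
  sorry

/-- STUB 3 (L): the a-priori package along the true evolution (integrability, bounds, slow blocks, mean
time-equicontinuity of the tested conserved fields) from the cubic-moment uniform integrability. -/
theorem stub_aprioriBlockFlux : CubicMomentUI → AprioriBlockFlux := by
  sorry

/-- STUB 4 (M/L): windows ⇒ closure — per-window assembly (`≤ 3δτ_N`), telescoping, Riemann sum vs. time
integral of the frozen flux (Fubini + slow variation), remainder window, truncation removed at the two
endpoints by `CubicMomentUI`; concludes the route's target `MesoFluxClosure` BY NAME with `α` from the heart. -/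
theorem stub_windowsToClosure :
    FieldRefresh → GibbsianisedWindowFlux → AprioriBlockFlux → CubicMomentUI → MesoFluxClosure := by
  sorry

/-! ### Name-keyed aliases of the stub statements (the hypotheses of the composition; the skeleton audit
admits a hypothesis only if its head constant is a registered obligation or is named like a declared stub) -/
namespace Registered

/-- Alias of the statement of `stub_fieldRefresh`. -/
abbrev stub_fieldRefresh : Prop := CellRefresh → FieldRefresh
/-- Alias of the statement of `stub_gibbsianisedWindowFlux`. -/
abbrev stub_gibbsianisedWindowFlux : Prop := CubicMomentUI → GibbsianisedWindowFlux
/-- Alias of the statement of `stub_aprioriBlockFlux`. -/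
abbrev stub_aprioriBlockFlux : Prop := CubicMomentUI → AprioriBlockFlux
/-- Alias of the statement of `stub_windowsToClosure`. -/
abbrev stub_windowsToClosure : Prop :=
  FieldRefresh → GibbsianisedWindowFlux → AprioriBlockFlux → CubicMomentUI → MesoFluxClosure

end Registered

/-! ### Composition (PROVED): the four stub statements imply the crux BY NAME -/

/-- **The line concludes the crux BY NAME**: the four registered stub statements imply
`Summit.AtomisticToContinuum.HydrodynamicLimit.Theses.HeatBathForgetting.RefreshToClosure` (no `sorry`):
given `CellRefresh` and `CubicMomentUI`, stub 1 yields `FieldRefresh`, stubs 2–3 yield the heart and the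
a-priori package from `CubicMomentUI`, and stub 4 assembles `MesoFluxClosure`. -/
theorem RefreshToClosure_of (hField : Registered.stub_fieldRefresh)
    (hHeart : Registered.stub_gibbsianisedWindowFlux) (hApriori : Registered.stub_aprioriBlockFlux)
    (hWindows : Registered.stub_windowsToClosure) : RefreshToClosure := by
  show CellRefresh → CubicMomentUI → MesoFluxClosure
  intro hCR hUI
  exact hWindows (hField hCR) (hHeart hUI) (hApriori hUI) hUI

/-- Wiring check: the registered stubs feed `RefreshToClosure_of` as stated. -/
example : RefreshToClosure :=
  RefreshToClosure_of stub_fieldRefresh stub_gibbsianisedWindowFlux stub_aprioriBlockFlux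
    stub_windowsToClosure

end Summit.AtomisticToContinuum.HydrodynamicLimit.Cruxes.RefreshToClosure.Birth

end
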